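import Summits.AtomisticToContinuum.Crystallization.Theorems.PricedLinkCensusSoftLayerPropagationOneStackingMapSearchLeaf
import HarnessLib

/-!
# The run of the one-stacking development search, part 15 of 53 (computational, `native_decide`)

Route `PricedLinkCensus`, crux `SoftLayerPropagation` (stmt-AtomisticToContinuum-14233), line
`Sketch`, stub `stub_oneStackingMap`.  The verified development search of
`…OneStackingMapSearchDefs.lean` / `…OneStackingMapSearchLeaf.lean` is run below the `211`
states of the depth-`3` frontier of the root, split round-robin into `53` parts (each state
searched with fuel `1000`; about `4.3 · 10⁵` expansion steps and `4227` leaves in all, every leaf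
passing the Barlow check at shadow radius `33/10`).  This file decides part `15` by
`native_decide`; the parts are assembled in `…OneStackingMapRunAll.lean`.  [folklore]
-/

namespace Summit.AtomisticToContinuum.Crystallization.Theorems

namespace OneStacking

/-- **Part `15` of `53` of the development search returns `true`** (frontier depth `3`, fuel
`1000`). [folklore] -/
theorem checkPart_eq_true_15 : St.checkPart 3 53 15 1000 = true := by
  native_decide

end OneStacking

end Summit.AtomisticToContinuum.Crystallization.Theorems
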